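import Summits.NavierStokesRegularity.NavierStokesRegularity.Theorems.TypeILiouvilleTypeIliouvilleNoTypeIIGradientPivotFastBalls
import HarnessLib

/-!
# `NoTypeII ⇔ GradientBKMSharp ∧ (scaled-energy Type I)` — the energy form of the residual
# (crux `TypeIliouvilleNoTypeII`, stmt-NavierStokesRegularity-0056, line `Sketch`
# (gradient-bkm-pivot), skeleton rev 4, dictionary of pass c2, second file)

Helper file (theorems only).  The landed `…GradientPivotFastBalls` proves
`NoTypeII ⇔ A ∧ B1` (A = BKM-sharp gradient, B1 = no fast parabolic balls) and that a uniform
Type-I bound on Seregin's centre-free scaled local energies at the parabolic scale,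
`∫_{B(x, √(T - t))} ‖u(t)‖² ≤ K √(T - t)`, implies B1.  This file closes the circle:

* `scaledEnergyTypeI_of_isTypeIBlowup`, `ballIntegralTypeI_of_isTypeIBlowup` — a Type-I blow-up
  of a classical solution has Type-I scaled energies and Type-I parabolic ball integrals of the
  speed (integrate the pointwise bound over the ball, `|B(x, r)| = r³ |B(0, 1)|`);
* `isTypeIBlowup_iff_noFastBalls_of_gradientSharp`,
  `isTypeIBlowup_iff_scaledEnergyTypeI_of_gradientSharp`,
  `isTypeIBlowup_iff_ballIntegralTypeI_of_gradientSharp` — for ONE classical solution on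
  `[0, T)` with BKM-sharp gradient near `T`, Type I ⇔ no fast parabolic balls ⇔ scaled-energy
  Type I ⇔ ball-integral Type I;
* `stub_noTypeII_iff_gradientSharp_and_scaledEnergyTypeI` (registered dictionary stub) —
  **`NoTypeII ⇔ A ∧ E`**, E = "every gradient-sharp maximal Leray–Hopf solution from a rapidly
  decaying datum is Type I in the energy sense (centre-free scaled energies bounded at the
  parabolic scale)".  So on the gradient-sharp side the crux IS the centre-free version of
  Seregin's Type-I condition `sup_r A(r) < ∞` (Seregin 2012, §1 (1.6)), nothing more and
  nothing less.
-/

noncomputable section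

-- the summit and its single problem share the name (D-0017 nested layout)
set_option linter.dupNamespace false

open Set Function Filter Topology MeasureTheory Metric
open scoped NNReal ENNReal

namespace Summit.NavierStokesRegularity.NavierStokesRegularity.Theorems.TypeIliouvilleNoTypeII.GradientPivot

open Literature.Analysis Literature.Analysis.FluidPDE

/-- `ℝ³`. -/
local notation "E3" => EuclideanSpace ℝ (Fin 3)

/-! ## Integrating a pointwise bound over a ball -/

/-- **A slow ball carries little of an integrand bounded above.**  If `f : ℝ³ → ℝ` is continuous
and `f ≤ c` on `B(x, r)`, `0 ≤ r`, then `∫_{B(x, r)} f ≤ c · r³ |B(0,1)|` (ball volume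
`|B(x, r)| = r³ |B(0,1)|` by the landed `threeFifthsGrad_volume_ball_toReal`). [folklore] -/
theorem setIntegral_ball_le_const_mul_volume {f : E3 → ℝ} (hf : Continuous f) (x : E3) {r c : ℝ}
    (hr : 0 ≤ r) (hfc : ∀ y ∈ ball x r, f y ≤ c) :
    ∫ y in ball x r, f y ≤ c * (r ^ 3 * (volume (ball (0 : E3) 1)).toReal) := by
  have hfi : IntegrableOn f (ball x r) volume :=
    (hf.continuousOn.integrableOn_compact (isCompact_closedBall x r)).mono_set
      ball_subset_closedBall
  have hci : IntegrableOn (fun _ : E3 => c) (ball x r) volume :=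
    integrableOn_const (hs := measure_ball_lt_top.ne)
  calc ∫ y in ball x r, f y ≤ ∫ _ in ball x r, c := setIntegral_mono_on hfi hci measurableSet_ball hfc
    _ = c * (r ^ 3 * (volume (ball (0 : E3) 1)).toReal) := by
        rw [setIntegral_const, smul_eq_mul, measureReal_def, threeFifthsGrad_volume_ball_toReal x hr,
          mul_comm]

/-! ## Type I ⇒ the averaged Type-I statements -/

/-- **Type I ⇒ scaled-energy Type I.**  For a classical solution on `[0, T)`, `0 < T`, the
Type-I rate `‖u(t, y)‖ ≤ C₀/√(T - t)` near `T` gives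
`∫_{B(x, √(T - t))} ‖u(t)‖² ≤ (max C₀ 0)² |B(0,1)| √(T - t)` near `T`, for every centre `x`.
[folklore] -/
theorem scaledEnergyTypeI_of_isTypeIBlowup {ν T : ℝ} (hT : 0 < T) {u : ℝ → E3 → E3}
    {p : ℝ → E3 → ℝ} (hsol : IsClassicalNSSolutionOn (Ico 0 T) ν 0 u p) (hI : IsTypeIBlowup u T) :
    ∃ K : ℝ, ∀ᶠ t in 𝓝[<] T, ∀ x : E3,
      ∫ y in ball x (Real.sqrt (T - t)), ‖u t y‖ ^ 2 ≤ K * Real.sqrt (T - t) := by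
  obtain ⟨C₀, hC₀⟩ := hI
  set ω : ℝ := (volume (ball (0 : E3) 1)).toReal with hω
  refine ⟨(max C₀ 0) ^ 2 * ω, ?_⟩
  filter_upwards [hC₀, Ico_mem_nhdsLT hT] with t ht htI x
  have hTt : 0 < T - t := sub_pos.2 htI.2
  set r : ℝ := Real.sqrt (T - t) with hr
  have hr0 : 0 < r := Real.sqrt_pos.2 hTt
  have hrr : r ^ 2 = T - t := Real.sq_sqrt hTt.le
  have hcont : Continuous fun y => ‖u t y‖ ^ 2 :=
    ((hsol.contDiff_velocity htI).continuous.norm).pow 2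
  -- pointwise `‖u t y‖² ≤ (max C₀ 0)²/(T - t)`
  have hpt : ∀ y ∈ ball x r, ‖u t y‖ ^ 2 ≤ (max C₀ 0) ^ 2 / (T - t) := fun y _ => by
    have h1 : ‖u t y‖ ≤ max C₀ 0 / r :=
      (ht y).trans (div_le_div_of_nonneg_right (le_max_left _ _) hr0.le)
    have h2 : ‖u t y‖ ^ 2 ≤ (max C₀ 0 / r) ^ 2 := pow_le_pow_left₀ (norm_nonneg _) h1 2
    rwa [div_pow, hrr] at h2
  refine (setIntegral_ball_le_const_mul_volume hcont x hr0.le hpt).trans_eq ?_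
  -- `(max C₀ 0)²/(T - t) · r³ ω = (max C₀ 0)² ω r`
  rw [← hrr, hω]
  field_simp

/-- **Type I ⇒ ball-integral Type I.**  For a classical solution on `[0, T)`, `0 < T`, the
Type-I rate near `T` gives `∫_{B(x, √(T - t))} ‖u(t)‖ ≤ (max C₀ 0) |B(0,1)| (T - t)` near `T`,
for every centre `x`. [folklore] -/
theorem ballIntegralTypeI_of_isTypeIBlowup {ν T : ℝ} (hT : 0 < T) {u : ℝ → E3 → E3}
    {p : ℝ → E3 → ℝ} (hsol : IsClassicalNSSolutionOn (Ico 0 T) ν 0 u p) (hI : IsTypeIBlowup u T) :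
    ∃ K : ℝ, ∀ᶠ t in 𝓝[<] T, ∀ x : E3,
      ∫ y in ball x (Real.sqrt (T - t)), ‖u t y‖ ≤ K * (T - t) := by
  obtain ⟨C₀, hC₀⟩ := hI
  set ω : ℝ := (volume (ball (0 : E3) 1)).toReal with hω
  refine ⟨max C₀ 0 * ω, ?_⟩
  filter_upwards [hC₀, Ico_mem_nhdsLT hT] with t ht htI x
  have hTt : 0 < T - t := sub_pos.2 htI.2
  set r : ℝ := Real.sqrt (T - t) with hr
  have hr0 : 0 < r := Real.sqrt_pos.2 hTt
  have hrr : r ^ 2 = T - t := Real.sq_sqrt hTt.le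
  have hcont : Continuous fun y => ‖u t y‖ := (hsol.contDiff_velocity htI).continuous.norm
  have hpt : ∀ y ∈ ball x r, ‖u t y‖ ≤ max C₀ 0 / r := fun y _ =>
    (ht y).trans (div_le_div_of_nonneg_right (le_max_left _ _) hr0.le)
  refine (setIntegral_ball_le_const_mul_volume hcont x hr0.le hpt).trans_eq ?_
  -- `(max C₀ 0)/r · r³ ω = (max C₀ 0) ω r²`
  rw [← hrr, hω]
  field_simp

/-! ## One solution, BKM-sharp gradient: the four forms of Type I agree -/

/-- For a classical solution on `[0, T)`, `0 < T`, with BKM-sharp gradient near `T`: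
**Type I ⇔ no fast parabolic balls**. [folklore] -/
theorem isTypeIBlowup_iff_noFastBalls_of_gradientSharp {ν T : ℝ} (hT : 0 < T) {u : ℝ → E3 → E3}
    {p : ℝ → E3 → ℝ} (hsol : IsClassicalNSSolutionOn (Ico 0 T) ν 0 u p)
    (hG : ∃ C₁ : ℝ, ∀ᶠ t in 𝓝[<] T, ∀ x, ‖fderiv ℝ (u t) x‖ ≤ C₁ / (T - t)) :
    IsTypeIBlowup u T ↔
      ∃ K : ℝ, ∀ᶠ t in 𝓝[<] T, ∀ x : E3, ∃ y ∈ ball x (Real.sqrt (T - t)),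
        ‖u t y‖ ≤ K / Real.sqrt (T - t) :=
  ⟨noFastBalls_of_isTypeIBlowup hT, isTypeIBlowup_of_noFastBalls hT hsol hG⟩

/-- For a classical solution on `[0, T)`, `0 < T`, with BKM-sharp gradient near `T`:
**Type I ⇔ scaled-energy Type I** (centre-free Seregin `A`-quantity bounded at the parabolic
scale). [cite: Seregin2012, §1 (1.6)] -/
theorem isTypeIBlowup_iff_scaledEnergyTypeI_of_gradientSharp {ν T : ℝ} (hT : 0 < T)
    {u : ℝ → E3 → E3} {p : ℝ → E3 → ℝ} (hsol : IsClassicalNSSolutionOn (Ico 0 T) ν 0 u p)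
    (hG : ∃ C₁ : ℝ, ∀ᶠ t in 𝓝[<] T, ∀ x, ‖fderiv ℝ (u t) x‖ ≤ C₁ / (T - t)) :
    IsTypeIBlowup u T ↔
      ∃ K : ℝ, ∀ᶠ t in 𝓝[<] T, ∀ x : E3,
        ∫ y in ball x (Real.sqrt (T - t)), ‖u t y‖ ^ 2 ≤ K * Real.sqrt (T - t) :=
  ⟨scaledEnergyTypeI_of_isTypeIBlowup hT hsol,
    fun hE => isTypeIBlowup_of_noFastBalls hT hsol hG (noFastBalls_of_scaledEnergy hT hsol hE)⟩

/-- For a classical solution on `[0, T)`, `0 < T`, with BKM-sharp gradient near `T`: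
**Type I ⇔ ball-integral Type I** (parabolic ball averages of the speed are Type I). [folklore] -/
theorem isTypeIBlowup_iff_ballIntegralTypeI_of_gradientSharp {ν T : ℝ} (hT : 0 < T)
    {u : ℝ → E3 → E3} {p : ℝ → E3 → ℝ} (hsol : IsClassicalNSSolutionOn (Ico 0 T) ν 0 u p)
    (hG : ∃ C₁ : ℝ, ∀ᶠ t in 𝓝[<] T, ∀ x, ‖fderiv ℝ (u t) x‖ ≤ C₁ / (T - t)) :
    IsTypeIBlowup u T ↔
      ∃ K : ℝ, ∀ᶠ t in 𝓝[<] T, ∀ x : E3,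
        ∫ y in ball x (Real.sqrt (T - t)), ‖u t y‖ ≤ K * (T - t) :=
  ⟨ballIntegralTypeI_of_isTypeIBlowup hT hsol,
    fun hA => isTypeIBlowup_of_noFastBalls hT hsol hG (noFastBalls_of_ballIntegral hT hsol hA)⟩

/-! ## Registered dictionary stub -/

/-- **Registered dictionary stub `stub_noTypeII_iff_gradientSharp_and_scaledEnergyTypeI` of the
line `Sketch` (gradient-bkm-pivot rev 4), crux `TypeIliouvilleNoTypeII`
(stmt-NavierStokesRegularity-0056)**: `NoTypeII ⇔ A ∧ E` — A = every maximal Leray–Hopf solution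
from a rapidly decaying datum has a BKM-sharp gradient near its lifespan; E = every such
gradient-sharp solution is Type I in the energy sense, i.e. its centre-free scaled local energies
at the parabolic scale are bounded, `∫_{B(x, √(T - t))} ‖u(t)‖² ≤ K √(T - t)` near `T`.  `→`:
`gradientSharp_of_noTypeII` and `scaledEnergyTypeI_of_isTypeIBlowup`; `←`: the landed
`noTypeII_of_gradientSharp_of_scaledEnergyTypeI`. [cite: Seregin2012, §1 (1.6)] -/
theorem stub_noTypeII_iff_gradientSharp_and_scaledEnergyTypeI :
    Summit.NavierStokesRegularity.NavierStokesRegularity.Theses.TypeILiouville.TypeIliouvilleNoTypeII ↔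
      ((∀ (ν T : ℝ), 0 < ν → 0 < T → ∀ (u : ℝ → E3 → E3) (p : ℝ → E3 → ℝ),
          IsMaximalSmoothSolution ν 0 u p T → IsLerayHopfOn T ν 0 (u 0) u →
          HasRapidSpatialDecay (u 0) →
          ∃ C : ℝ, ∀ᶠ t in 𝓝[<] T, ∀ x, ‖fderiv ℝ (u t) x‖ ≤ C / (T - t)) ∧
        (∀ (ν T : ℝ), 0 < ν → 0 < T → ∀ (u : ℝ → E3 → E3) (p : ℝ → E3 → ℝ),
          IsMaximalSmoothSolution ν 0 u p T → IsLerayHopfOn T ν 0 (u 0) u →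
          HasRapidSpatialDecay (u 0) →
          (∃ C₁ : ℝ, ∀ᶠ t in 𝓝[<] T, ∀ x, ‖fderiv ℝ (u t) x‖ ≤ C₁ / (T - t)) →
          ∃ K : ℝ, ∀ᶠ t in 𝓝[<] T, ∀ x : E3,
            ∫ y in ball x (Real.sqrt (T - t)), ‖u t y‖ ^ 2 ≤ K * Real.sqrt (T - t))) := by
  constructor
  · intro h
    exact ⟨gradientSharp_of_noTypeII h, fun ν T hν hT u p hmax hLH hdec _ =>
      scaledEnergyTypeI_of_isTypeIBlowup hT hmax.1 (h ν T hν hT u p hmax hLH hdec)⟩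
  · rintro ⟨hA, hE⟩
    exact noTypeII_of_gradientSharp_of_scaledEnergyTypeI hA hE

end Summit.NavierStokesRegularity.NavierStokesRegularity.Theorems.TypeIliouvilleNoTypeII.GradientPivot

end
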